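import Summits.AnomalousDissipation.AnomalousDissipation.Theorems.EnsembleRigidityGPTameDefectFloorParityForm2
import HarnessLib

/-!
# Tools A for stub `stub_gpParityForm3` of line `Sketch` (crux stmt-AnomalousDissipation-17938, `EnsembleRigidity.GPTameDefectFloor`) — the lattice bookkeeping of the `7/100` enstrophy certificate: ratio weights from an integer potential table

The `7/100` certificate `∫ (v ⊗ v) : ∇f_GP ≥ -(7/100) ‖∇v‖²` (file `…ParityForm3.lean`, horizon
`G₁ < 150/7`) bounds each term of `I(u) = 2π Σⱼ Σₖ Re(conj ûⱼ(k - eⱼ) ûⱼ₊₁(k))` by weighted AM–GM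
with *ratio weights*: a SLOT is `(p, m)` (the scalar coefficient `ûₘ(p)`), the term indexed by
`(j, k)` is the EDGE `(k - eⱼ, j) → (k, j+1)`, and on a live edge `a → b` the weights are
`Φ(b)/Φ(a)` on `|û_a|²` and `Φ(a)/Φ(b)` on `|û_b|²` (product one) for a potential `Φ > 0`. Edges
through a ZERO SLOT (`p = 0`, where `û(0) = 0`, or `|p|² = 1` with `pₘ ≠ 0`, where `ûₘ(±eₘ) = 0` by
`k · û(k) = 0`) are dropped (weight `0`). The charge on a slot `s = (p, m)` is then
`(Φ(A_s) + Φ(B_s))/Φ(s)`, `A_s = (p + eₘ, m+1)`, `B_s = (p - eₘ₋₁, m-1)` its live neighbours, and the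
certificate needs `Φ(A_s) + Φ(B_s) ≤ K |p|² Φ(s)`, `K = 4π · 7/100 = 7π/25`, off the shell `|p|² = 2`,
plus two grouped inequalities on `|p|² = 2` (slots at `±p`, the in-plane pair tied by `p · c = 0`).
Here `Φ(p, m) = T₇(|p|², pₘ², pₘ₊₁², pₘ₋₁²)` for an explicit integer table `T₇` (`36` feature
classes on `|p|² ≤ 12`, a constant tail; such tables reach `c₀ ≈ 0.0694`, all termwise schemes
`≥ 0.0618`, the sharp constant is `0.0583`). The `1422` integer inequalities on the box `[-4, 4]³`
(all `|p|² ≤ 24`) are ONE kernel `decide`, with `K` replaced by its minorant `0.879645`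
(`Real.pi_gt_d6`); for `|p|² ≥ 25` all potentials involved are the tail constant. Everything but the
`decide` is proved for an abstract table `T`, so the elaborator never unfolds `T₇`;
`form3_weight_exists_of` packages the weights `α(p, m)` (slot `(p, m)` against `(p + eₘ, m+1)`) and
`β(p, m)` (slot `(p, m+1)` against `(p - eₘ, m)`) with the properties consumed by
`…ParityForm3ToolsB.lean`. References: FMRT 2001, Ch. IV (the form `b`); Constantin–Foias 1988,
Ch. 4 (4.33).
-/

-- `Summit.<Summit>.<Problem>` is the tree's mandated summit-side namespace (CONVENTIONS §2); single-conjunct summit, duplicate deliberate.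
set_option linter.dupNamespace false

noncomputable section

namespace Summit.AnomalousDissipation.AnomalousDissipation.Theorems.EnsembleRigidity.GPTameDefectFloor

open MeasureTheory Filter Topology UnitAddTorus
open scoped InnerProductSpace RealInnerProductSpace ENNReal NNReal
open Literature.Analysis.FunctionSpaces Literature.Analysis.FluidPDE
open Summit.AnomalousDissipation.AnomalousDissipation.Theorems.EnsembleRigidity

/-- Local notation: real vector fields on `T³`. -/
local notation "Vec3" => (UnitAddTorus (Fin 3)) → (EuclideanSpace ℝ (Fin 3))
/-- Local notation: `L²(T³; ℝ³)`. -/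
local notation "L2" => (Lp (EuclideanSpace ℝ (Fin 3)) 2 (volume : Measure (UnitAddTorus (Fin 3))))
/-- Local notation: the energy space `H`. -/
local notation "H3" => (Torus.energySpace (Fin 3))

/-! ## Slots, zero slots, potentials, charges (local notations; `T` an abstract table) -/

/-- `|p|² = Σᵢ pᵢ² ∈ ℤ` for `p ∈ ℤ³`. -/
local notation "ν[" p "]" => (∑ i : Fin 3, (p : Fin 3 → ℤ) i ^ (2 : ℕ))
/-- The unit vectors `eₘ ∈ ℤ³`. -/
local notation "𝐞[" m "]" => (Pi.single (m : Fin 3) (1 : ℤ) : Fin 3 → ℤ)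
set_option quotPrecheck false in
/-- Zero slots `(p, m)`: `p = 0`, or `|p|² = 1` with `pₘ ≠ 0` (a longitudinal shell-`1` slot). -/
local notation "Z[" p ", " m "]" => (ν[p] = 0 ∨ (ν[p] = 1 ∧ (p : Fin 3 → ℤ) (m : Fin 3) ≠ 0))
set_option quotPrecheck false in
/-- The potential `Φ_T(p, m) = T(|p|², pₘ², pₘ₊₁², pₘ₋₁²) ∈ ℕ` of the slot `(p, m)`. -/
local notation "Φ[" T ", " p ", " m "]" => ((T : ℤ → ℤ → ℤ → ℤ → ℕ) ν[p]
  ((p : Fin 3 → ℤ) (m : Fin 3) ^ (2 : ℕ)) ((p : Fin 3 → ℤ) ((m : Fin 3) + 1) ^ (2 : ℕ))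
  ((p : Fin 3 → ℤ) ((m : Fin 3) - 1) ^ (2 : ℕ)))
set_option quotPrecheck false in
/-- Charge numerator of the slot `(p, m+1)`: potentials of its live neighbours `(p + eₘ₊₁, m+2)`,
`(p - eₘ, m)`. -/
local notation "N[" T ", " p ", " m "]" =>
  ((if Z[p + 𝐞[m + 1], m + 1 + 1] then (0 : ℤ) else ((Φ[T, p + 𝐞[m + 1], m + 1 + 1] : ℕ) : ℤ)) +
    (if Z[p - 𝐞[m], m] then (0 : ℤ) else ((Φ[T, p - 𝐞[m], m] : ℕ) : ℤ)))
set_option quotPrecheck false in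
/-- Integer budget of the slot `(p, m+1)` (`0.879645 ≤ 4π · 7/100`). -/
local notation "SB[" T ", " p ", " m "]" =>
  (Z[p, m + 1] ∨ (10 : ℤ) ^ (6 : ℕ) * N[T, p, m] ≤ 879645 * ν[p] * ((Φ[T, p, m + 1] : ℕ) : ℤ))
set_option quotPrecheck false in
/-- Shell-`2` data of `p`: an out-of-plane index `m` exists; for it `pₘ₊₁² = pₘ₊₂² = 1` and the
grouped integer budgets of the slots `(±p, m)` and of the four tied slots `(±p, m+1)`, `(±p, m+2)`. -/
local notation "S2[" T ", " p "]" =>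
  ((∃ m : Fin 3, (p : Fin 3 → ℤ) m = 0) ∧ ∀ m : Fin 3, (p : Fin 3 → ℤ) m = 0 →
    (p : Fin 3 → ℤ) (m + 1) ^ (2 : ℕ) = 1 ∧ (p : Fin 3 → ℤ) (m + 1 + 1) ^ (2 : ℕ) = 1 ∧
    (10 : ℤ) ^ (6 : ℕ) * (N[T, p, m + 1 + 1] + N[T, -p, m + 1 + 1]) ≤
      879645 * 4 * ((Φ[T, p, m] : ℕ) : ℤ) ∧
    (10 : ℤ) ^ (6 : ℕ) * (N[T, p, m] + N[T, p, m + 1] + N[T, -p, m] + N[T, -p, m + 1]) ≤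
      879645 * 8 * ((Φ[T, p, m + 1] : ℕ) : ℤ))
set_option quotPrecheck false in
/-- All the integer budgets on the box `[-4, 4]³ ⊇ {|p|² ≤ 24}`. -/
local notation "BOX[" T "]" =>
  (∀ p0 ∈ Finset.Icc (-4 : ℤ) 4, ∀ p1 ∈ Finset.Icc (-4 : ℤ) 4, ∀ p2 ∈ Finset.Icc (-4 : ℤ) 4,
    (ν[![p0, p1, p2]] = 2 → S2[T, ![p0, p1, p2]]) ∧
    (ν[![p0, p1, p2]] = 0 ∨ ν[![p0, p1, p2]] = 2 ∨ 24 < ν[![p0, p1, p2]] ∨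
      ∀ m : Fin 3, SB[T, ![p0, p1, p2], m]))
set_option quotPrecheck false in
/-- The weight `α_T(p, m)` on the slot `(p, m)` against its partner `(p + eₘ, m+1)`. -/
local notation "wA[" T ", " p ", " m "]" =>
  (if Z[p, m] ∨ Z[p + 𝐞[m], m + 1] then (0 : ℝ)
    else ((Φ[T, p + 𝐞[m], m + 1] : ℕ) : ℝ) / ((Φ[T, p, m] : ℕ) : ℝ))
set_option quotPrecheck false in
/-- The weight `β_T(p, m)` on the slot `(p, m+1)` against its partner `(p - eₘ, m)`. -/
local notation "wB[" T ", " p ", " m "]" =>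
  (if Z[p, m + 1] ∨ Z[p - 𝐞[m], m] then (0 : ℝ)
    else ((Φ[T, p - 𝐞[m], m] : ℕ) : ℝ) / ((Φ[T, p, m + 1] : ℕ) : ℝ))
set_option quotPrecheck false in
/-- The potential table `T₇` of the `7/100` certificate: `Φ(p, m) = T₇(|p|², pₘ², pₘ₊₁², pₘ₋₁²)`
(`36` feature classes on the shells `|p|² ≤ 12`, the constant `27649` beyond; clamped to its own range
`[9077, 10⁷]`, which makes the bounds used by the analysis structural). -/
local notation "TT" => (fun (n a b c : ℤ) => max 9077 (min 10000000
  (if 12 < n then (27649 : ℕ)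
  else if n = 2 ∧ a = 1 then (4362729 : ℕ) else if n = 1 ∧ a = 0 ∧ b = 0 ∧ c = 1 then (8816630 : ℕ)
  else if n = 1 ∧ a = 0 ∧ b = 1 ∧ c = 0 then (10000000 : ℕ) else if n = 10 ∧ a = 0 ∧ b = 1 ∧ c = 9 then (151417 : ℕ)
  else if n = 10 ∧ a = 0 ∧ b = 9 ∧ c = 1 then (51665 : ℕ) else if n = 10 ∧ a = 1 ∧ b = 0 ∧ c = 9 then (129382 : ℕ)
  else if n = 10 ∧ a = 1 ∧ b = 9 ∧ c = 0 then (12047 : ℕ) else if n = 10 ∧ a = 9 ∧ b = 0 ∧ c = 1 then (129382 : ℕ)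
  else if n = 10 ∧ a = 9 ∧ b = 1 ∧ c = 0 then (136502 : ℕ) else if n = 11 ∧ a = 1 ∧ b = 1 ∧ c = 9 then (77468 : ℕ)
  else if n = 11 ∧ a = 1 ∧ b = 9 ∧ c = 1 then (29998 : ℕ) else if n = 11 ∧ a = 9 ∧ b = 1 ∧ c = 1 then (92450 : ℕ)
  else if n = 12 ∧ a = 4 ∧ b = 4 ∧ c = 4 then (23572 : ℕ) else if n = 2 ∧ a = 0 ∧ b = 1 ∧ c = 1 then (4930482 : ℕ)
  else if n = 3 ∧ a = 1 ∧ b = 1 ∧ c = 1 then (3550230 : ℕ) else if n = 4 ∧ a = 0 ∧ b = 0 ∧ c = 4 then (59236 : ℕ)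
  else if n = 4 ∧ a = 0 ∧ b = 4 ∧ c = 0 then (702609 : ℕ) else if n = 4 ∧ a = 4 ∧ b = 0 ∧ c = 0 then (2762426 : ℕ)
  else if n = 5 ∧ a = 0 ∧ b = 1 ∧ c = 4 then (1095969 : ℕ) else if n = 5 ∧ a = 0 ∧ b = 4 ∧ c = 1 then (197666 : ℕ)
  else if n = 5 ∧ a = 1 ∧ b = 0 ∧ c = 4 then (1161048 : ℕ) else if n = 5 ∧ a = 1 ∧ b = 4 ∧ c = 0 then (824736 : ℕ)
  else if n = 5 ∧ a = 4 ∧ b = 0 ∧ c = 1 then (1291186 : ℕ) else if n = 5 ∧ a = 4 ∧ b = 1 ∧ c = 0 then (1095969 : ℕ)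
  else if n = 6 ∧ a = 1 ∧ b = 1 ∧ c = 4 then (835671 : ℕ) else if n = 6 ∧ a = 1 ∧ b = 4 ∧ c = 1 then (418686 : ℕ)
  else if n = 6 ∧ a = 4 ∧ b = 1 ∧ c = 1 then (715893 : ℕ) else if n = 8 ∧ a = 0 ∧ b = 4 ∧ c = 4 then (182724 : ℕ)
  else if n = 8 ∧ a = 4 ∧ b = 0 ∧ c = 4 then (146468 : ℕ) else if n = 8 ∧ a = 4 ∧ b = 4 ∧ c = 0 then (203939 : ℕ)
  else if n = 9 ∧ a = 0 ∧ b = 0 ∧ c = 9 then (358350 : ℕ) else if n = 9 ∧ a = 0 ∧ b = 9 ∧ c = 0 then (32951 : ℕ)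
  else if n = 9 ∧ a = 1 ∧ b = 4 ∧ c = 4 then (132385 : ℕ) else if n = 9 ∧ a = 4 ∧ b = 1 ∧ c = 4 then (106632 : ℕ)
  else if n = 9 ∧ a = 4 ∧ b = 4 ∧ c = 1 then (114431 : ℕ) else if n = 9 ∧ a = 9 ∧ b = 0 ∧ c = 0 then (9077 : ℕ)
  else (27649 : ℕ))))

/-! ## The table and its integer budgets (the only computations with the concrete table) -/
/-- **All `1422` integer budgets of the table `T₇` on the box `[-4, 4]³`** (every slot of every
`p` with `|p|² ≤ 24`, `|p|² ≠ 2`, and the grouped shell-`2` budgets), by kernel reduction.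
[folklore] -/
theorem form3_box : BOX[TT] := by
  -- one kernel evaluation of ≈ 4400 table look-ups (≈ 30 s); the elaborator never unfolds `T₇`
  decide +kernel

/-- The table `T₇` takes values in `[9077, 10⁷]` (by its clamp), is the constant `27649` on
`|p|² > 12`, and has the common in-plane value `4362729` on the shell `|p|² = 2`. [folklore] -/
theorem form3_table : (∀ n a b c, 9077 ≤ TT n a b c) ∧ (∀ n a b c, TT n a b c ≤ 10 ^ 7) ∧
    (∀ n a b c, 12 < n → TT n a b c = 27649) ∧ (∀ b c, TT 2 1 b c = 4362729) := by
  refine ⟨fun n a b c => le_max_left _ _, fun n a b c => max_le (by norm_num) (min_le_left _ _),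
    fun n a b c hn => ?_, fun b c => ?_⟩ <;> dsimp only
  · rw [if_pos hn]
    rfl
  · rw [if_neg (by norm_num), if_pos ⟨rfl, rfl⟩]
    rfl

/-- `10⁶ X ≤ 879645 n P` gives `X/P ≤ (7π/25) n` (`0.879645 ≤ 7π/25`, `Real.pi_gt_d6`).
[folklore] -/
theorem form3_arith {P : ℕ} {X n : ℤ} (hP : 0 < P) (hn : 0 ≤ n) (h : 10 ^ 6 * X ≤ 879645 * n * P) :
    (X : ℝ) / (P : ℝ) ≤ 7 * Real.pi / 25 * (n : ℝ) := by
  have hP' : (0 : ℝ) < P := by exact_mod_cast hP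
  have hn' : (0 : ℝ) ≤ n := by exact_mod_cast hn
  have h' : (10 : ℝ) ^ 6 * X ≤ 879645 * n * P := by exact_mod_cast h
  have h1 : (0 : ℝ) ≤ (7 * Real.pi / 25 - 879645 / 10 ^ 6) * (n * P) :=
    mul_nonneg (by linarith [Real.pi_gt_d6]) (mul_nonneg hn' hP'.le)
  rw [div_le_iff₀ hP']
  nlinarith

/-- The charge of a non-zero slot `(p, m+1)` is `N(p, m+1)/Φ(p, m+1)`. [folklore] -/
theorem form3_charge (T : ℤ → ℤ → ℤ → ℤ → ℕ) (p : Fin 3 → ℤ) (m : Fin 3) (hZ : ¬ Z[p, m + 1]) :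
    wA[T, p, m + 1] + wB[T, p, m] = ((N[T, p, m] : ℤ) : ℝ) / ((Φ[T, p, m + 1] : ℕ) : ℝ) := by
  have e1 : wA[T, p, m + 1] = (if Z[p + 𝐞[m + 1], m + 1 + 1] then (0 : ℝ)
      else ((Φ[T, p + 𝐞[m + 1], m + 1 + 1] : ℕ) : ℝ)) / ((Φ[T, p, m + 1] : ℕ) : ℝ) := by
    by_cases hA : Z[p + 𝐞[m + 1], m + 1 + 1]
    · rw [if_pos (Or.inr hA), if_pos hA, zero_div]
    · rw [if_neg (fun h => h.elim hZ hA), if_neg hA]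
  have e2 : wB[T, p, m] = (if Z[p - 𝐞[m], m] then (0 : ℝ)
      else ((Φ[T, p - 𝐞[m], m] : ℕ) : ℝ)) / ((Φ[T, p, m + 1] : ℕ) : ℝ) := by
    by_cases hB : Z[p - 𝐞[m], m]
    · rw [if_pos (Or.inr hB), if_pos hB, zero_div]
    · rw [if_neg (fun h => h.elim hZ hB), if_neg hB]
  rw [e1, e2, ← add_div]
  simp only [Int.cast_add, Int.cast_ite, Int.cast_zero, Int.cast_natCast]

/-- **Slot budget.** The integer budget `SB` of the slot `(p, m+1)` gives the real budget
`α(p, m+1) + β(p, m) ≤ (7π/25) |p|²` of its two weights. [folklore] -/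
theorem form3_slot (T : ℤ → ℤ → ℤ → ℤ → ℕ) (hT : ∀ n a b c, 0 < T n a b c) (p : Fin 3 → ℤ)
    (m : Fin 3) (h : SB[T, p, m]) :
    wA[T, p, m + 1] + wB[T, p, m] ≤ 7 * Real.pi / 25 * ((ν[p] : ℤ) : ℝ) := by
  have hn : (0 : ℤ) ≤ ν[p] := Finset.sum_nonneg fun i _ => sq_nonneg (p i)
  by_cases hZ : Z[p, m + 1]
  · have hn' : (0 : ℝ) ≤ ((ν[p] : ℤ) : ℝ) := by exact_mod_cast hn
    rw [if_pos (Or.inl hZ), if_pos (Or.inl hZ), add_zero]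
    positivity
  · rw [form3_charge T p m hZ]
    exact form3_arith (hT _ _ _ _) hn (h.resolve_left hZ)

/-- `|p|² ≥ 25 ⟹ |p ± eⱼ|² ≥ 13` (`|p ± eⱼ|² = |p|² ± 2pⱼ + 1 ≥ (|pⱼ| - 1)²`). [folklore] -/
theorem form3_shift_ge (p : Fin 3 → ℤ) (j : Fin 3) (h : 25 ≤ ν[p]) :
    13 ≤ ν[p + 𝐞[j]] ∧ 13 ≤ ν[p - 𝐞[j]] := by
  have hj : p j ^ 2 ≤ ν[p] :=
    Finset.single_le_sum (f := fun i => p i ^ 2) (fun i _ => sq_nonneg (p i)) (Finset.mem_univ j)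
  rw [(form2_normSq_shift p j).1, (form2_normSq_shift p j).2]
  constructor
  · by_cases ht : 0 ≤ p j + 6 <;> nlinarith
  · by_cases ht : p j ≤ 6 <;> nlinarith

/-- **Tail slots.** For `|p|² ≥ 25` all three potentials of a slot are the tail constant (the
neighbours have `|·|² ≥ 13`), so its charge is `2 ≤ (7π/25) |p|²`. [folklore] -/
theorem form3_tail_slot (T : ℤ → ℤ → ℤ → ℤ → ℕ) (hTt : ∀ n a b c, 12 < n → T n a b c = 27649)
    (p : Fin 3 → ℤ) (h25 : 25 ≤ ν[p]) (m : Fin 3) :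
    wA[T, p, m + 1] + wB[T, p, m] ≤ 7 * Real.pi / 25 * ((ν[p] : ℤ) : ℝ) := by
  obtain ⟨⟨hA, -⟩, -, hB⟩ := And.intro (form3_shift_ge p (m + 1) h25) (form3_shift_ge p m h25)
  have nZ : ∀ (q : Fin 3 → ℤ) (i : Fin 3), 13 ≤ ν[q] → ¬ Z[q, i] := fun q i hq hz => by
    rcases hz with hz | ⟨hz, _⟩ <;> omega
  rw [if_neg (fun h => h.elim (nZ p _ (by omega)) (nZ _ _ hA)),
    if_neg (fun h => h.elim (nZ p _ (by omega)) (nZ _ _ hB)),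
    hTt _ _ _ _ (by omega : 12 < ν[p + 𝐞[m + 1]]), hTt _ _ _ _ (by omega : 12 < ν[p - 𝐞[m]]),
    hTt _ _ _ _ (by omega : 12 < ν[p])]
  have h25' : (25 : ℝ) ≤ ((ν[p] : ℤ) : ℝ) := by exact_mod_cast h25
  rw [show ((27649 : ℕ) : ℝ) / ((27649 : ℕ) : ℝ) = 1 from div_self (by norm_num)]
  nlinarith [Real.pi_gt_d6]

/-- Cyclic splitting of a sum over `Fin 3` from any index. [folklore] -/
theorem form3_sum3 {M : Type*} [AddCommMonoid M] (f : Fin 3 → M) (m : Fin 3) :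
    ∑ i, f i = f m + f (m + 1) + f (m + 1 + 1) := by
  rw [← Fintype.sum_equiv (Equiv.addLeft m) (fun i => f (m + i)) f (fun i => rfl),
    Fin.sum_univ_three, add_zero, add_assoc m 1 1]
  rfl

/-- `m + 3 = m` in `Fin 3`. [folklore] -/
theorem form3_add3 (m : Fin 3) : m + 1 + 1 + 1 = m := by revert m; decide

/-- **Point budget off the shell `2`** from the three slot budgets:
`Σₘ (α(p,m)|cₘ|² + β(p,m)|cₘ₊₁|²) ≤ (7π/25) |p|² ‖c‖²`. [folklore] -/
theorem form3_point (T : ℤ → ℤ → ℤ → ℤ → ℕ) (p : Fin 3 → ℤ)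
    (hs : ∀ m : Fin 3, wA[T, p, m + 1] + wB[T, p, m] ≤ 7 * Real.pi / 25 * ((ν[p] : ℤ) : ℝ))
    (c : Fin 3 → ℂ) :
    ∑ m, (wA[T, p, m] * ‖c m‖ ^ 2 + wB[T, p, m] * ‖c (m + 1)‖ ^ 2) ≤
      7 * Real.pi / 25 * Torus.freqNormSq p * ∑ m, ‖c m‖ ^ 2 := by
  have h0 := mul_le_mul_of_nonneg_right (hs 0) (sq_nonneg ‖c (0 + 1)‖)
  have h1 := mul_le_mul_of_nonneg_right (hs 1) (sq_nonneg ‖c (1 + 1)‖)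
  have h2 := mul_le_mul_of_nonneg_right (hs 2) (sq_nonneg ‖c (2 + 1)‖)
  rw [form2_cast] at h0 h1 h2
  simp only [Fin.sum_univ_three, zero_add, form2_fin_succ] at h0 h1 h2 ⊢
  linarith

/-- A lattice point with `|p|² ≤ 24` lies in the box, so `BOX` applies to it. [folklore] -/
theorem form3_box_at (T : ℤ → ℤ → ℤ → ℤ → ℕ) (hbox : BOX[T]) (p : Fin 3 → ℤ) (h24 : ν[p] ≤ 24) :
    (ν[p] = 2 → S2[T, p]) ∧ (ν[p] = 0 ∨ ν[p] = 2 ∨ 24 < ν[p] ∨ ∀ m : Fin 3, SB[T, p, m]) := by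
  have hb : ∀ i, p i ∈ Finset.Icc (-4 : ℤ) 4 := fun i => by
    have hi : p i ^ 2 ≤ ν[p] :=
      Finset.single_le_sum (f := fun i => p i ^ 2) (fun i _ => sq_nonneg (p i)) (Finset.mem_univ i)
    exact Finset.mem_Icc.2 ⟨by nlinarith, by nlinarith⟩
  have hp : ![p 0, p 1, p 2] = p := by ext i; fin_cases i <;> rfl
  have h := hbox (p 0) (hb 0) (p 1) (hb 1) (p 2) (hb 2)
  rwa [hp] at h

/-- **The pointwise budget off the shells `0`, `2`** (tail slots for `|p|² ≥ 25`, the table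
budgets inside the box). [folklore] -/
theorem form3_hW4 (T : ℤ → ℤ → ℤ → ℤ → ℕ) (hT : ∀ n a b c, 0 < T n a b c)
    (hTt : ∀ n a b c, 12 < n → T n a b c = 27649) (hbox : BOX[T]) (p : Fin 3 → ℤ) (hp0 : p ≠ 0)
    (hp2 : Torus.freqNormSq p ≠ 2) (c : Fin 3 → ℂ) :
    ∑ m, (wA[T, p, m] * ‖c m‖ ^ 2 + wB[T, p, m] * ‖c (m + 1)‖ ^ 2) ≤
      7 * Real.pi / 25 * Torus.freqNormSq p * ∑ m, ‖c m‖ ^ 2 := by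
  refine form3_point T p (fun m => ?_) c
  by_cases h25 : 25 ≤ ν[p]
  · exact form3_tail_slot T hTt p h25 m
  · obtain ⟨-, h⟩ := form3_box_at T hbox p (by omega)
    rcases h with h | h | h | h
    · exact absurd (form2_eq_zero_of_normSq p h) hp0
    · exact absurd (by rw [← form2_cast, h]; norm_num) hp2
    · omega
    · exact form3_slot T hT p m (h m)

/-- **The symmetrised shell-`2` budget.** For `|p|² = 2` and transversal `c ⊥ p` the charges of the
six slots at `p` and `-p` total at most `2 · (7π/25) · 2 ‖c‖²`: with `m` the out-of-plane index,
`|c_{m+1}| = |c_{m+2}|` (from `p · c = 0`), the four in-plane slots have the common potential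
`T(2, 1, ·, ·)`, and the two grouped integer budgets of `S2` are exactly what is needed. [folklore] -/
theorem form3_hW5 (T : ℤ → ℤ → ℤ → ℤ → ℕ) (hT : ∀ n a b c, 0 < T n a b c) (Pin : ℕ)
    (hin : ∀ b c, T 2 1 b c = Pin) (hbox : BOX[T]) (p : Fin 3 → ℤ)
    (hp2 : Torus.freqNormSq p = 2) (c : Fin 3 → ℂ) (hc : ∑ i, (p i : ℂ) * c i = 0) :
    ∑ m, (wA[T, p, m] * ‖c m‖ ^ 2 + wB[T, p, m] * ‖c (m + 1)‖ ^ 2) +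
      ∑ m, (wA[T, -p, m] * ‖c m‖ ^ 2 + wB[T, -p, m] * ‖c (m + 1)‖ ^ 2) ≤
      2 * (7 * Real.pi / 25 * 2 * ∑ m, ‖c m‖ ^ 2) := by
  have hν : ν[p] = 2 := by exact_mod_cast (form2_cast p).trans hp2
  have hνn : ν[-p] = ν[p] := by simp
  obtain ⟨⟨m, hm⟩, hall⟩ := (form3_box_at T hbox p (by omega)).1 hν
  obtain ⟨hs1, hs2, hout, hinn⟩ := hall m hm
  have nZ : ∀ i : Fin 3, ¬ Z[p, i] := fun i h => by rcases h with h | ⟨h, _⟩ <;> omega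
  have nZ' : ∀ i : Fin 3, ¬ Z[-p, i] := fun i h => by rcases h with h | ⟨h, _⟩ <;> omega
  have E1 := form3_charge T p (m + 1 + 1) (nZ _)
  have E1' := form3_charge T (-p) (m + 1 + 1) (nZ' _)
  have E2 := form3_charge T p m (nZ _)
  have E2' := form3_charge T (-p) m (nZ' _)
  have E3 := form3_charge T p (m + 1) (nZ _)
  have E3' := form3_charge T (-p) (m + 1) (nZ' _)
  have I1 := form3_arith (n := 4) (hT _ _ _ _) (by norm_num) hout
  have I2 := form3_arith (n := 8) (hT _ _ _ _) (by norm_num) hinn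
  have hP1 : T ν[p] (p (m + 1) ^ 2) (p (m + 1 + 1) ^ 2) (p (m + 1 - 1) ^ 2) = Pin := by
    rw [hν, hs1]; exact hin _ _
  have hP2 : T ν[p] (p (m + 1 + 1) ^ 2) (p m ^ 2) (p (m + 1 + 1 - 1) ^ 2) = Pin := by
    rw [hν, hs2]; exact hin _ _
  have hc' : (p (m + 1) : ℂ) * c (m + 1) + (p (m + 1 + 1) : ℂ) * c (m + 1 + 1) = 0 := by
    rw [form3_sum3 (fun i => (p i : ℂ) * c i) m] at hc
    simpa only [hm, Int.cast_zero, zero_mul, zero_add] using hc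
  have tie : ‖c (m + 1)‖ ^ 2 = ‖c (m + 1 + 1)‖ ^ 2 := by
    have h1 := congrArg (fun z : ℂ => ‖z‖ ^ 2) (eq_neg_of_add_eq_zero_left hc')
    simp only [norm_neg, norm_mul, mul_pow, Complex.norm_intCast, sq_abs] at h1
    have e1 : ((p (m + 1) : ℤ) : ℝ) ^ 2 = 1 := by exact_mod_cast hs1
    have e2 : ((p (m + 1 + 1) : ℤ) : ℝ) ^ 2 = 1 := by exact_mod_cast hs2
    rw [e1, e2, one_mul, one_mul] at h1
    exact h1
  rw [form3_sum3 (fun i => wA[T, p, i] * ‖c i‖ ^ 2 + wB[T, p, i] * ‖c (i + 1)‖ ^ 2) m,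
    form3_sum3 (fun i => wA[T, -p, i] * ‖c i‖ ^ 2 + wB[T, -p, i] * ‖c (i + 1)‖ ^ 2) m,
    form3_sum3 (fun i => ‖c i‖ ^ 2) m]
  simp only [form3_add3, Pi.neg_apply, neg_sq, neg_ne_zero] at E1 E1' E2 E2' E3 E3' I1 I2 ⊢
  push_cast at E1 E1' E2 E2' E3 E3' I1 I2 ⊢
  simp only [hP1, hP2, add_div] at E1 E1' E2 E2' E3 E3' I1 I2 ⊢
  rw [tie]
  linarith [mul_le_mul_of_nonneg_right I1 (sq_nonneg ‖c m‖),
    mul_le_mul_of_nonneg_right I2 (sq_nonneg ‖c (m + 1 + 1)‖),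
    congrArg (· * ‖c m‖ ^ 2) E1, congrArg (· * ‖c m‖ ^ 2) E1',
    congrArg (· * ‖c (m + 1 + 1)‖ ^ 2) E2, congrArg (· * ‖c (m + 1 + 1)‖ ^ 2) E2',
    congrArg (· * ‖c (m + 1 + 1)‖ ^ 2) E3, congrArg (· * ‖c (m + 1 + 1)‖ ^ 2) E3']

/-! ## Zero slots, live edges, bounds, and the packaged weights -/
/-- A zero slot `(q, j)` has `q` supported on the axis `j`. [folklore] -/
theorem form3_Z_support (q : Fin 3 → ℤ) (j : Fin 3) (h : Z[q, j]) (i : Fin 3) (hi : i ≠ j) :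
    q i = 0 := by
  have hsq : ∀ l, q l ^ 2 ≤ ν[q] := fun l =>
    Finset.single_le_sum (f := fun l => q l ^ 2) (fun l _ => sq_nonneg (q l)) (Finset.mem_univ l)
  have h2 : q j ^ 2 + q i ^ 2 ≤ ν[q] := by
    rw [← Finset.sum_pair (f := fun l => q l ^ 2) hi.symm]
    exact Finset.sum_le_sum_of_subset_of_nonneg (Finset.subset_univ _) fun l _ _ => sq_nonneg (q l)
  have hi0 : q i ^ 2 ≤ 0 := by
    rcases h with h | ⟨h, hj⟩
    · exact (hsq i).trans h.le
    · rcases lt_or_gt_of_ne hj with hlt | hlt <;> nlinarith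
  exact pow_eq_zero_iff two_ne_zero |>.1 (le_antisymm hi0 (sq_nonneg _))

/-- **Live edges have product one.** Along the edge `(k - eⱼ, j) → (k, j+1)` either an end is a
zero slot (then its point is supported on the slot's own axis) or
`α(k - eⱼ, j) β(k, j) = (Φ(b)/Φ(a)) (Φ(a)/Φ(b)) = 1`. [folklore] -/
theorem form3_edge (T : ℤ → ℤ → ℤ → ℤ → ℕ) (hT : ∀ n a b c, 0 < T n a b c) (k : Fin 3 → ℤ)
    (j : Fin 3) : (∀ i, i ≠ j → (k - Pi.single j 1 : Fin 3 → ℤ) i = 0) ∨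
      (∀ i, i ≠ j + 1 → k i = 0) ∨ 1 ≤ wA[T, k - 𝐞[j], j] * wB[T, k, j] := by
  by_cases h1 : Z[k - 𝐞[j], j]
  · exact Or.inl (form3_Z_support _ _ h1)
  by_cases h2 : Z[k, j + 1]
  · exact Or.inr (Or.inl (form3_Z_support _ _ h2))
  refine Or.inr (Or.inr (le_of_eq ?_))
  simp only [sub_add_cancel]
  have ha : (0 : ℝ) < (Φ[T, k - 𝐞[j], j] : ℕ) := by exact_mod_cast hT _ _ _ _
  have hb : (0 : ℝ) < (Φ[T, k, j + 1] : ℕ) := by exact_mod_cast hT _ _ _ _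
  rw [if_neg (fun h => h.elim h1 h2), if_neg (fun h => h.elim h2 h1), div_mul_div_comm, mul_comm,
    div_self (by positivity)]

/-- The weights lie in `[0, 1102]` for a table with values in `[9077, 10⁷]`. [folklore] -/
theorem form3_wbound (T : ℤ → ℤ → ℤ → ℤ → ℕ) (hlo : ∀ n a b c, 9077 ≤ T n a b c)
    (hhi : ∀ n a b c, T n a b c ≤ 10 ^ 7) (p : Fin 3 → ℤ) (m : Fin 3) :
    (0 ≤ wA[T, p, m] ∧ wA[T, p, m] ≤ 1102) ∧ (0 ≤ wB[T, p, m] ∧ wB[T, p, m] ≤ 1102) := by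
  have key : ∀ n a b c n' a' b' c', (T n a b c : ℝ) / (T n' a' b' c' : ℝ) ≤ 1102 := by
    intro n a b c n' a' b' c'
    have ha : (T n a b c : ℝ) ≤ 10 ^ 7 := by exact_mod_cast hhi n a b c
    have hs : (9077 : ℝ) ≤ T n' a' b' c' := by exact_mod_cast hlo n' a' b' c'
    rw [div_le_iff₀ (by linarith)]
    linarith
  constructor
  · by_cases h : Z[p, m] ∨ Z[p + 𝐞[m], m + 1]
    · rw [if_pos h]; norm_num
    · rw [if_neg h]; exact ⟨by positivity, key ..⟩
  · by_cases h : Z[p, m + 1] ∨ Z[p - 𝐞[m], m]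
    · rw [if_pos h]; norm_num
    · rw [if_neg h]; exact ⟨by positivity, key ..⟩

/-- Packaging, for an abstract table `T` with values in `[9077, 10⁷]`, constant `27649` beyond
`|p|² = 12`, a common in-plane shell-`2` value, and all box budgets: the weights `α_T`, `β_T` have
the seven properties consumed by the analytic layer. [folklore] -/
theorem form3_weight_exists_of (T : ℤ → ℤ → ℤ → ℤ → ℕ) (hlo : ∀ n a b c, 9077 ≤ T n a b c)
    (hhi : ∀ n a b c, T n a b c ≤ 10 ^ 7) (htail : ∀ n a b c, 12 < n → T n a b c = 27649)
    {Pin : ℕ} (hin : ∀ b c, T 2 1 b c = Pin) (hbox : BOX[T]) :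
    ∃ α β : (Fin 3 → ℤ) → Fin 3 → ℝ,
    (∀ p m, 0 ≤ α p m) ∧ (∀ p m, 0 ≤ β p m) ∧ (∀ p m, α p m ≤ 1102) ∧ (∀ p m, β p m ≤ 1102) ∧
    (∀ (k : Fin 3 → ℤ) (j : Fin 3), (∀ i, i ≠ j → (k - Pi.single j 1 : Fin 3 → ℤ) i = 0) ∨
      (∀ i, i ≠ j + 1 → k i = 0) ∨ 1 ≤ α (k - Pi.single j 1) j * β k j) ∧
    (∀ p : Fin 3 → ℤ, p ≠ 0 → Torus.freqNormSq p ≠ 2 → ∀ c : Fin 3 → ℂ,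
      ∑ m, (α p m * ‖c m‖ ^ 2 + β p m * ‖c (m + 1)‖ ^ 2) ≤
        7 * Real.pi / 25 * Torus.freqNormSq p * ∑ m, ‖c m‖ ^ 2) ∧
    (∀ p : Fin 3 → ℤ, Torus.freqNormSq p = 2 → ∀ c : Fin 3 → ℂ, ∑ i, (p i : ℂ) * c i = 0 →
      ∑ m, (α p m * ‖c m‖ ^ 2 + β p m * ‖c (m + 1)‖ ^ 2) +
        ∑ m, (α (-p) m * ‖c m‖ ^ 2 + β (-p) m * ‖c (m + 1)‖ ^ 2) ≤
        2 * (7 * Real.pi / 25 * 2 * ∑ m, ‖c m‖ ^ 2)) := by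
  have hT : ∀ n a b c, 0 < T n a b c := fun n a b c => lt_of_lt_of_le (by norm_num) (hlo n a b c)
  exact ⟨fun p m => wA[T, p, m], fun p m => wB[T, p, m],
    fun p m => (form3_wbound T hlo hhi p m).1.1, fun p m => (form3_wbound T hlo hhi p m).2.1,
    fun p m => (form3_wbound T hlo hhi p m).1.2, fun p m => (form3_wbound T hlo hhi p m).2.2,
    form3_edge T hT, form3_hW4 T hT htail hbox, form3_hW5 T hT Pin hin hbox⟩

/-- **Tools stub `stub_gpParityForm3ToolsA` — the slot weights of the `7/100` certificate**
(`form3_weight_exists_of` for the table `T₇`): `α, β : ℤ³ × Fin 3 → [0, 1102]` with product `≥ 1`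
along every edge unless an end point is supported on the slot's own axis, the pointwise budget
`Σₘ (α(p,m)|cₘ|² + β(p,m)|cₘ₊₁|²) ≤ (7π/25) |p|² ‖c‖²` off the shells `0, 2`, and the symmetrised
shell-`2` budget for transversal `c ⊥ p`. [folklore] -/
theorem stub_gpParityForm3ToolsA : ∃ α β : (Fin 3 → ℤ) → Fin 3 → ℝ, (∀ p m, 0 ≤ α p m) ∧ (∀ p m, 0 ≤ β p m) ∧ (∀ p m, α p m ≤ 1102) ∧ (∀ p m, β p m ≤ 1102) ∧ (∀ (k : Fin 3 → ℤ) (j : Fin 3), (∀ i, i ≠ j → (k - Pi.single j 1 : Fin 3 → ℤ) i = 0) ∨ (∀ i, i ≠ j + 1 → k i = 0) ∨ 1 ≤ α (k - Pi.single j 1) j * β k j) ∧ (∀ p : Fin 3 → ℤ, p ≠ 0 → Torus.freqNormSq p ≠ 2 → ∀ c : Fin 3 → ℂ, ∑ m, (α p m * ‖c m‖ ^ 2 + β p m * ‖c (m + 1)‖ ^ 2) ≤ 7 * Real.pi / 25 * Torus.freqNormSq p * ∑ m, ‖c m‖ ^ 2) ∧ (∀ p : Fin 3 → ℤ, Torus.freqNormSq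 p = 2 → ∀ c : Fin 3 → ℂ, ∑ i, (p i : ℂ) * c i = 0 → ∑ m, (α p m * ‖c m‖ ^ 2 + β p m * ‖c (m + 1)‖ ^ 2) + ∑ m, (α (-p) m * ‖c m‖ ^ 2 + β (-p) m * ‖c (m + 1)‖ ^ 2) ≤ 2 * (7 * Real.pi / 25 * 2 * ∑ m, ‖c m‖ ^ 2)) :=
  form3_weight_exists_of TT form3_table.1 form3_table.2.1 form3_table.2.2.1 form3_table.2.2.2
    form3_box

end Summit.AnomalousDissipation.AnomalousDissipation.Theorems.EnsembleRigidity.GPTameDefectFloor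

end
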